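import Mathlib
import Summits.ValiantsHypothesis.ValiantsHypothesis.Theses.GirthSidon
import Summits.ValiantsHypothesis.ValiantsHypothesis.Theorems.GirthSidonMomentCurveElusiveEchelon

/-!
# GirthSidon — cancellation budget for formally swallowed exponent vectors
(helper lemmas for the crux `MomentCurveElusive`, item `stmt-ValiantsHypothesis-6534`,
line `registered` / `Lines/birth.lean`, stub `stub_swallowedInSmallSumset`; part 2 of 2 —
part 1, `GirthSidonMomentCurveElusiveEchelon.lean`, has the echelon lemma and the quadratic-span
bookkeeping)

Setting of the load-bearing stub: Laurent series `y₁, …, y_s ∈ ℂ((t))`, a quadratic map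
`Γ : ℂ^s → ℂ^m` (coordinates of total degree `≤ 2`) and an injective exponent vector
`D : Fin m → ℕ` with `Γ_i(y) = t^{D_i}` for all `i` ("formal swallowing").  Write
`V = span_ℂ(1, y₁, …, y_s)` and `O = ord(V ∖ 0) ⊂ ℤ` for the set of `t`-orders of its nonzero
elements (`|O| = finrank V ≤ s + 1` by the echelon lemma).  This file proves the structural fact
recorded in the crux's strategy census (`Cruxes/MomentCurveElusive/STRATEGY-CENSUS.md`,
§Strengthen S2, L2) on which the partial results towards the stub rest:

* `card_born_add_card_sumset_le` / `born_card_add_card_sumset_le` — **cancellation budget**: the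
  targets `D_i` lying OUTSIDE the honest sumset `O + O` ("cancellation-born" targets) together
  with `O + O` number at most `C(|O| + 1, 2)`;
* `exists_cover_card_le_budget` — hence `D ⊆ U + U` for `U = O ∪ {0} ∪ {born targets}`, of size
  `≤ |O| + 1 + (C(|O|+1,2) − |O+O|)`: the stub's conclusion whenever the budget is `≤ m^{0.95} − s − 2`;
* `forall_mem_sumset_of_sidon` — if `O` is a Sidon set the budget is `0`: every target is honest,
  `D_i ∈ O + O`, and the stub's conclusion holds with `U = O`, `|U| ≤ s + 1`.

Proof of the budget: every `t^{D_i}` and every product `v · v'` (`v, v' ∈ V ∖ 0`) lies in a space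
`W ⊇ V · V` of dimension `≤ C(finrank V + 1, 2)`; the orders of nonzero elements of `W` are at most
`finrank W` many (echelon lemma) and contain the disjoint union of `{D_i : D_i ∉ O + O}` and
`O + O`; and `|O| = finrank V`.

These are `--supports` lemmas: they do not close the stub (whose open content is exactly a bound
`m^{0.95}` on the cover number when the budget is large), but they settle its honest /
Sidon-order / small-budget regimes.
-/

-- `Summit.ValiantsHypothesis.ValiantsHypothesis.…` is the tree's mandated single-conjunct layout
-- (Sub = Summit), so the duplicated namespace component is intended.
set_option linter.dupNamespace false

namespace Summit.ValiantsHypothesis.ValiantsHypothesis.Theorems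

open scoped Pointwise

section Budget

variable {K : Type*} [Field K]

/-- **Cancellation budget, subspace form.** If distinct monomials `t^{D_i}` lie in `V · V` for a
finite-dimensional `V ⊂ K((t))` with order set `O = ord(V ∖ 0)`, then the indices `i` with
`D_i ∉ O + O` ("cancellation-born") together with `O + O` number at most `C(|O| + 1, 2)`
(both sit inside `ord(W ∖ 0)` for a space `W ⊇ V · V` of that dimension, and `|O| = finrank V`).
[folklore] -/
theorem card_born_add_card_sumset_le (V : Submodule K (LaurentSeries K)) [FiniteDimensional K V]
    {m : ℕ} (D : Fin m → ℤ) (hD : Function.Injective D)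
    (hmem : ∀ i, HahnSeries.single (D i) (1 : K) ∈ Submodule.span K ((V : Set (LaurentSeries K)) * (V : Set (LaurentSeries K)))) :
    (Finset.univ.filter fun i => D i ∉ (orders_finite V).toFinset + (orders_finite V).toFinset).card
      + ((orders_finite V).toFinset + (orders_finite V).toFinset).card
      ≤ ((orders_finite V).toFinset.card + 1).choose 2 := by
  classical
  set O := (orders_finite V).toFinset with hOdef
  obtain ⟨W, hWfd, hVW, hW⟩ := exists_mul_self_le_finrank_le V
  set B := Finset.univ.filter fun i => D i ∉ O + O with hB
  have hZ : (↑(B.image D ∪ (O + O)) : Set ℤ) ⊆ {e : ℤ | ∃ v ∈ W, v ≠ 0 ∧ v.order = e} := by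
    intro e he
    simp only [Finset.coe_union, Finset.coe_image, Set.mem_union, Set.mem_image,
      Finset.mem_coe] at he
    rcases he with ⟨i, _, rfl⟩ | he
    · exact ⟨_, hVW (hmem i), by simp, HahnSeries.order_single one_ne_zero⟩
    · rw [Finset.mem_add] at he
      obtain ⟨a, ha, a', ha', rfl⟩ := he
      rw [hOdef, Set.Finite.mem_toFinset] at ha ha'
      obtain ⟨v, hv, hv0, rfl⟩ := ha
      obtain ⟨v', hv', hv0', rfl⟩ := ha'
      exact ⟨v * v', hVW (Submodule.subset_span (Set.mul_mem_mul hv hv')), mul_ne_zero hv0 hv0',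
        HahnSeries.order_mul hv0 hv0'⟩
  haveI := hWfd
  have hcard := card_le_finrank_of_subset_orders W _ hZ
  have hdisj : Disjoint (B.image D) (O + O) := by
    rw [Finset.disjoint_left]
    intro e he he'
    simp only [Finset.mem_image, hB, Finset.mem_filter, Finset.mem_univ, true_and] at he
    obtain ⟨i, hi, rfl⟩ := he
    exact hi he'
  rw [Finset.card_union_of_disjoint hdisj, Finset.card_image_of_injective _ hD] at hcard
  have hO : O.card = Module.finrank K V := card_orders_eq_finrank V
  rw [hO]
  omega

/-- **Cancellation budget for the stub `stub_swallowedInSmallSumset`.** In the setting of the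
stub (`Γ` quadratic, `Γ_i(y) = t^{D_i}`, `D` injective) let `O` be the set of `t`-orders of the
nonzero elements of `V = span_K(1, y₁, …, y_s)`. Then `|O| ≤ s + 1` and the cancellation-born
targets (`D_i ∉ O + O`) together with `O + O` number at most `C(|O| + 1, 2)`. [folklore] -/
theorem born_card_add_card_sumset_le {s m : ℕ} (y : Fin s → LaurentSeries K) (D : Fin m → ℕ)
    (hD : Function.Injective D) (Γ : Fin m → MvPolynomial (Fin s) K)
    (hΓ : ∀ i, (Γ i).totalDegree ≤ 2)
    (hy : ∀ i, MvPolynomial.aeval y (Γ i) = HahnSeries.single (D i : ℤ) (1 : K)) :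
    ∃ O : Finset ℤ, (↑O = {e : ℤ | ∃ v ∈ Submodule.span K (insert 1 (Set.range y)), v ≠ 0 ∧ v.order = e}) ∧
      O.card ≤ s + 1 ∧
      (Finset.univ.filter fun i : Fin m => (D i : ℤ) ∉ O + O).card + (O + O).card
        ≤ (O.card + 1).choose 2 := by
  classical
  set g : Option (Fin s) → LaurentSeries K := fun o => o.elim 1 y with hg
  have hrange : Set.range g = insert 1 (Set.range y) := by
    ext x
    simp only [hg, Set.mem_range, Set.mem_insert_iff]
    constructor
    · rintro ⟨o, rfl⟩
      cases o with
      | none => exact Or.inl rfl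
      | some j => exact Or.inr ⟨j, rfl⟩
    · rintro (rfl | ⟨j, rfl⟩)
      · exact ⟨none, rfl⟩
      · exact ⟨some j, rfl⟩
  set V := Submodule.span K (insert 1 (Set.range y)) with hV
  haveI : FiniteDimensional K V := by
    rw [hV, ← hrange]; exact FiniteDimensional.span_of_finite K (Set.finite_range g)
  have hfin : Module.finrank K V ≤ s + 1 := by
    have h := finrank_range_le_card (R := K) g
    rw [hrange] at h
    simpa [Set.finrank] using h
  have h1 : (1 : LaurentSeries K) ∈ V := Submodule.subset_span (Set.mem_insert _ _)
  have hyV : ∀ j, y j ∈ V := fun j => Submodule.subset_span (Set.mem_insert_of_mem _ ⟨j, rfl⟩)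
  have hmem : ∀ i, HahnSeries.single ((fun i => (D i : ℤ)) i) (1 : K) ∈ Submodule.span K ((V : Set (LaurentSeries K)) * (V : Set (LaurentSeries K))) := by
    intro i
    rw [← hy i]
    exact aeval_mem_mul_self_of_totalDegree_le_two y V h1 hyV (Γ i) (hΓ i)
  have hDinj : Function.Injective fun i => (D i : ℤ) := (Nat.cast_injective (R := ℤ)).comp hD
  refine ⟨(orders_finite V).toFinset, by simp, ?_, card_born_add_card_sumset_le V _ hDinj hmem⟩
  rw [card_orders_eq_finrank V]
  exact hfin

/-- **Corollary (cover by honest orders plus born targets).** In the setting of the stub there is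
a cover `D ⊆ U + U` by `U = O ∪ {0} ∪ {born targets}`, of size at most
`|O| + 1 + (C(|O|+1, 2) − |O + O|)` with `|O| ≤ s + 1`: the stub's conclusion holds whenever the
cancellation budget `C(|O|+1,2) − |O+O|` is at most `m^{0.95} − s − 2`. [folklore] -/
theorem exists_cover_card_le_budget {s m : ℕ} (y : Fin s → LaurentSeries K) (D : Fin m → ℕ)
    (hD : Function.Injective D) (Γ : Fin m → MvPolynomial (Fin s) K)
    (hΓ : ∀ i, (Γ i).totalDegree ≤ 2)
    (hy : ∀ i, MvPolynomial.aeval y (Γ i) = HahnSeries.single (D i : ℤ) (1 : K)) :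
    ∃ O U : Finset ℤ, (↑O = {e : ℤ | ∃ v ∈ Submodule.span K (insert 1 (Set.range y)), v ≠ 0 ∧ v.order = e}) ∧
      O.card ≤ s + 1 ∧
      U.card + (O + O).card ≤ O.card + 1 + (O.card + 1).choose 2 ∧
      ∀ i, ∃ a ∈ U, ∃ b ∈ U, (D i : ℤ) = a + b := by
  classical
  obtain ⟨O, hO, hOs, hbud⟩ := born_card_add_card_sumset_le y D hD Γ hΓ hy
  set B := Finset.univ.filter fun i : Fin m => (D i : ℤ) ∉ O + O with hB
  refine ⟨O, O ∪ {0} ∪ B.image (fun i => (D i : ℤ)), hO, hOs, ?_, fun i => ?_⟩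
  · have h1 : (O ∪ {0} ∪ B.image fun i => (D i : ℤ)).card ≤ O.card + 1 + B.card :=
      (Finset.card_union_le _ _).trans (Nat.add_le_add
        ((Finset.card_union_le _ _).trans (by simp)) Finset.card_image_le)
    omega
  · by_cases hi : (D i : ℤ) ∈ O + O
    · rw [Finset.mem_add] at hi
      obtain ⟨a, ha, b, hb, hab⟩ := hi
      exact ⟨a, by simp [ha], b, by simp [hb], hab.symm⟩
    · refine ⟨(D i : ℤ), ?_, 0, by simp, by simp⟩
      have hiB : i ∈ B := by simp [hB, hi]
      exact Finset.mem_union_right _ (Finset.mem_image_of_mem _ hiB)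

/-- **Corollary (Sidon order sets admit no cancellation).** If the order set `O` of
`span_K(1, y₁, …, y_s)` is a Sidon set (all sums of two elements distinct up to order), then in the
setting of the stub every target is honest: `D_i ∈ O + O` for all `i` — the stub's conclusion with
`U = O`, `|U| ≤ s + 1`. [folklore] -/
theorem forall_mem_sumset_of_sidon {s m : ℕ} (y : Fin s → LaurentSeries K) (D : Fin m → ℕ)
    (hD : Function.Injective D) (Γ : Fin m → MvPolynomial (Fin s) K)
    (hΓ : ∀ i, (Γ i).totalDegree ≤ 2)
    (hy : ∀ i, MvPolynomial.aeval y (Γ i) = HahnSeries.single (D i : ℤ) (1 : K))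
    (O : Finset ℤ) (hO : ↑O = {e : ℤ | ∃ v ∈ Submodule.span K (insert 1 (Set.range y)), v ≠ 0 ∧ v.order = e})
    (hSidon : ∀ a ∈ O, ∀ b ∈ O, ∀ c ∈ O, ∀ d ∈ O, a + b = c + d →
      (a = c ∧ b = d) ∨ (a = d ∧ b = c)) :
    O.card ≤ s + 1 ∧ ∀ i, ∃ a ∈ O, ∃ b ∈ O, (D i : ℤ) = a + b := by
  classical
  obtain ⟨O', hO', hOs, hbud⟩ := born_card_add_card_sumset_le y D hD Γ hΓ hy
  have hOO : O' = O := Finset.coe_injective (hO'.trans hO.symm)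
  subst hOO
  refine ⟨hOs, fun i => ?_⟩
  -- a Sidon set has `|O + O| = C(|O| + 1, 2)`
  let add2 : Sym2 ℤ → ℤ := Sym2.lift ⟨fun a b => a + b, fun a b => add_comm a b⟩
  have himg : O'.sym2.image add2 = O' + O' := by
    ext e
    simp only [Finset.mem_image, Finset.mem_add]
    constructor
    · rintro ⟨z, hz, rfl⟩
      induction z using Sym2.ind with
      | h a b =>
        rw [Finset.mk_mem_sym2_iff] at hz
        exact ⟨a, hz.1, b, hz.2, rfl⟩
    · rintro ⟨a, ha, b, hb, rfl⟩
      exact ⟨s(a, b), Finset.mk_mem_sym2_iff.2 ⟨ha, hb⟩, rfl⟩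
  have hinj : Set.InjOn add2 ↑O'.sym2 := by
    intro z hz z' hz' hzz
    induction z using Sym2.ind with
    | h a b =>
      induction z' using Sym2.ind with
      | h c d =>
        simp only [Finset.mem_coe, Finset.mk_mem_sym2_iff] at hz hz'
        rcases hSidon a hz.1 b hz.2 c hz'.1 d hz'.2 hzz with ⟨rfl, rfl⟩ | ⟨rfl, rfl⟩
        · rfl
        · exact Sym2.eq_swap
  have hcard : (O' + O').card = (O'.card + 1).choose 2 := by
    rw [← himg, Finset.card_image_of_injOn hinj, Finset.card_sym2]
  have hB : (Finset.univ.filter fun i : Fin m => (D i : ℤ) ∉ O' + O').card = 0 := by omega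
  rw [Finset.card_eq_zero, Finset.filter_eq_empty_iff] at hB
  have hi : (D i : ℤ) ∈ O' + O' := by simpa using hB (Finset.mem_univ i)
  rw [Finset.mem_add] at hi
  obtain ⟨a, ha, b, hb, hab⟩ := hi
  exact ⟨a, ha, b, hb, hab.symm⟩

/-- **Cancellation budget, registered helper form** (sub-goal `helper_bornBudget` of item
`stmt-ValiantsHypothesis-6534`; `O + O` spelled `Finset.image₂ (· + ·) O O`). [folklore] -/
theorem helper_bornBudget : ∀ (s m : ℕ) (y : Fin s → LaurentSeries ℂ) (D : Fin m → ℕ), Function.Injective D → ∀ (Γ : Fin m → MvPolynomial (Fin s) ℂ), (∀ i, (Γ i).totalDegree ≤ 2) → (∀ i, MvPolynomial.aeval y (Γ i) = HahnSeries.single (D i : ℤ) (1 : ℂ)) → ∃ O : Finset ℤ, (↑O = {e : ℤ | ∃ v ∈ Submodule.span ℂ (insert 1 (Set.range y)), v ≠ 0 ∧ v.order = e}) ∧ O.card ≤ s + 1 ∧ (Finset.univ.filter fun i : Fin m => (D i : ℤ) ∉ Finset.image₂ (· + ·) O O).card + (Finset.image₂ (· + ·) O O).card ≤ (O.card + 1).choose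 2 := by
  intro s m y D hD Γ hΓ hy
  exact born_card_add_card_sumset_le y D hD Γ hΓ hy

end Budget

end Summit.ValiantsHypothesis.ValiantsHypothesis.Theorems
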